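import Mathlib
import HarnessLib
import Literature.Computability.AlgebraicComplexity.StandardFamilies
import Literature.Computability.AlgebraicComplexity.PermanentIrreducible
import Literature.Computability.AlgebraicComplexity.DeterminantIrreducible

/-!
# Bi-set-multilinear (row/column-graded) circuits: a cancellation-tolerant Jerrum–Snir count

Workshop `decomp-valiant` (cycle 1 = VALIANT), lens 6 «restricted-models lifting axis», generation 24 —
KERNEL CERTIFICATE of census cell **D3** (COSTUME-CENSUS-v22: «BI-SET-MULTILINEAR circuits BSM_n … a
cancellation-tolerant Jerrum–Snir LABEL-COUNTING bound»; paper proof CLEARED by the critic, STATUS 654;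
`rung_ladder.next`: «OPTIONAL kernel port»). Nothing here is about the summit: `VP ≠ VNP` is NOT proved,
this is LADDER-Valiant rung 0, and the bound is a CALIBRATION of the restricted-models axis — it holds
for the permanent AND the determinant alike (the method is det-blind, as the census records).

THE MODEL (`Term`, `Term.WF`, `Term.eval`). A *bi-set-multilinear term* over the matrix variables
`x_{(r,c)}` (`r c : ι`) is built from inputs `x_{(r,c)}` (label `({r},{c})`), constants (label `(∅,∅)`),
sums and scalar multiples (label unchanged; a sum is well formed only between EQUAL labels) and products
(only between terms with DISJOINT row labels and DISJOINT column labels; the label of a product is the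
union). Coefficients are arbitrary — CANCELLATIONS ARE ALLOWED, unlike Jerrum–Snir's monotone model.
A well-formed term computes a polynomial whose monomials use only variables in `rows × cols`
(`Term.vars_subset`), and `#rows = #cols` (`Term.card_rows_eq_card_cols`). `Term.labels t` = the set of
DISTINCT labels of subterms of `t`; a circuit (DAG) with `s` gates obeying the discipline unfolds to a
term with at most `s` distinct labels, so a lower bound on `#labels` bounds CIRCUIT size (size and
straight-line-program corollaries, and an explicit well-formed term for `per` — non-vacuity of the
class — go to the companion file `BiSetMultilinearPrograms.lean`).

THE THEOREM (`Term.choose_le_card_windowLabels`). Let `N = card ι ≥ 2`. If a well-formed term with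
column label `univ` computes a polynomial whose support contains every permutation monomial
`∏_c x_{(π c, c)}` — e.g. `per` or `det` over a nontrivial commutative ring — then the number of distinct
labels `(R, C)` of its subterms with `N < 3·#C ≤ 2N` is at least `C(N, ⌈N/3⌉) = 2^{H(1/3)N - O(log N)}`
(`perPoly_lower_bound`, `detPoly_lower_bound`).

PROOF (Jerrum–Snir's parse-tree descent [JerrumSnir1982, §3], made cancellation-tolerant by the
grading). Supports of sums lie in the union, supports of products in the Minkowski sum of the supports;
so a monomial `m ∈ supp (t·u)` splits as `m = a + b`, `a ∈ supp t`, `b ∈ supp u`, and by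
column-disjointness `a` is `m` restricted to `cols t`. Descending along the factor with more columns
reaches a window subterm `g` (`N/3 < #cols g ≤ 2N/3`) such that `m` restricted to `cols g` uses only
rows of `rows g` (`Term.descent`). For `m = μ_π`: `π(cols g) ⊆ rows g`; for a balanced label `(R, C)`,
`#R = #C = j`, at most `j!(N-j)!` permutations do that (`Term.card_fiber_le`, an injection into
`(C ↪ R) × (Cᶜ ↪ Rᶜ)`), and `j!(N-j)! ≤ ⌈N/3⌉!(N-⌈N/3⌉)!` on the window; sum over window labels.
References: [JerrumSnir1982] M. Jerrum, M. Snir, J. ACM 29 (1982) 874–897, §§3–4 (the monotone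
original; tree: `Literature/Barriers/ValiantsHypothesis/MonotoneGapPermanentLower.lean`); the graded
cancellation-tolerant form: census row D3 (lens 6 NOTES-g16 §2 (O1); critic STATUS 654), folklore.
-/

noncomputable section

open MvPolynomial Finset
open scoped Nat

-- lint debt (as in every `…ValiantsHypothesis.Theorems.*` file): the mandated namespace repeats a component.
set_option linter.dupNamespace false

namespace Summit.ValiantsHypothesis.ValiantsHypothesis.Theorems.BiSetMultilinearCounting

open Literature.Computability.AlgebraicComplexity

universe u v

/-- Bi-set-multilinear terms over the matrix variables `ι × ι` with coefficients in `k`. -/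
inductive Term (k : Type u) (ι : Type v) : Type (max u v)
  | input (r c : ι) : Term k ι
  | const (a : k) : Term k ι
  | add (t u : Term k ι) : Term k ι
  | smul (a : k) (t : Term k ι) : Term k ι
  | mul (t u : Term k ι) : Term k ι

namespace Term

variable {k : Type u} {ι : Type v}

/-- The polynomial a term computes. -/
def eval [CommRing k] : Term k ι → MvPolynomial (ι × ι) k
  | input r c => X (r, c)
  | const a => C a
  | add t u => eval t + eval u
  | smul a t => a • eval t
  | mul t u => eval t * eval u

variable [DecidableEq ι]

/-- Row label of a term. -/
def rows : Term k ι → Finset ι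
  | input r _ => {r}
  | const _ => ∅
  | add t _ => rows t
  | smul _ t => rows t
  | mul t u => rows t ∪ rows u

/-- Column label of a term. -/
def cols : Term k ι → Finset ι
  | input _ c => {c}
  | const _ => ∅
  | add t _ => cols t
  | smul _ t => cols t
  | mul t u => cols t ∪ cols u

/-- Well-formedness: sums join equal labels, products join row-disjoint and column-disjoint labels. -/
def WF : Term k ι → Prop
  | input _ _ => True
  | const _ => True
  | add t u => WF t ∧ WF u ∧ rows u = rows t ∧ cols u = cols t
  | smul _ t => WF t
  | mul t u => WF t ∧ WF u ∧ Disjoint (rows t) (rows u) ∧ Disjoint (cols t) (cols u)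

/-- The set of labels `(rows, cols)` of all subterms (the term itself included). -/
def labels : Term k ι → Finset (Finset ι × Finset ι)
  | input r c => {(({r} : Finset ι), ({c} : Finset ι))}
  | const _ => {((∅ : Finset ι), (∅ : Finset ι))}
  | add t u => insert (rows t, cols t) (labels t ∪ labels u)
  | smul _ t => insert (rows t, cols t) (labels t)
  | mul t u => insert (rows t ∪ rows u, cols t ∪ cols u) (labels t ∪ labels u)

/-- A term's own label is among its labels. -/
theorem label_mem_labels (t : Term k ι) : (t.rows, t.cols) ∈ t.labels := by
  cases t <;> simp [labels, rows, cols]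

/-- `#rows = #cols` for well-formed terms. -/
theorem card_rows_eq_card_cols : ∀ t : Term k ι, t.WF → t.rows.card = t.cols.card
  | input _ _, _ => by simp [rows, cols]
  | const _, _ => by simp [rows, cols]
  | add t _, h => card_rows_eq_card_cols t h.1
  | smul _ t, h => card_rows_eq_card_cols t h
  | mul t u, h => by
      simp only [rows, cols]
      rw [card_union_of_disjoint h.2.2.1, card_union_of_disjoint h.2.2.2,
        card_rows_eq_card_cols t h.1, card_rows_eq_card_cols u h.2.1]

/-- Every label of a subterm of a well-formed term is balanced, with columns inside the term's. -/
theorem of_mem_labels : ∀ t : Term k ι, t.WF → ∀ L ∈ t.labels, L.1.card = L.2.card ∧ L.2 ⊆ t.cols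
  | input r c, _, L, hL => by
      simp only [labels, mem_singleton] at hL; subst hL; simp [cols]
  | const a, _, L, hL => by
      simp only [labels, mem_singleton] at hL; subst hL; simp
  | add t u, h, L, hL => by
      simp only [labels, mem_insert, mem_union] at hL
      rcases hL with rfl | hL | hL
      · exact ⟨card_rows_eq_card_cols t h.1, subset_rfl⟩
      · exact of_mem_labels t h.1 L hL
      · exact ⟨(of_mem_labels u h.2.1 L hL).1,
          (of_mem_labels u h.2.1 L hL).2.trans (by simp [cols, h.2.2.2])⟩
  | smul a t, h, L, hL => by
      simp only [labels, mem_insert] at hL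
      rcases hL with rfl | hL
      · exact ⟨card_rows_eq_card_cols t h, subset_rfl⟩
      · exact of_mem_labels t h L hL
  | mul t u, h, L, hL => by
      simp only [labels, mem_insert, mem_union] at hL
      rcases hL with rfl | hL | hL
      · exact ⟨card_rows_eq_card_cols (mul t u) h, subset_rfl⟩
      · exact ⟨(of_mem_labels t h.1 L hL).1, (of_mem_labels t h.1 L hL).2.trans (by simp [cols])⟩
      · exact ⟨(of_mem_labels u h.2.1 L hL).1, (of_mem_labels u h.2.1 L hL).2.trans (by simp [cols])⟩

/-- The variables of the computed polynomial lie in `rows × cols`. -/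
theorem vars_subset [CommRing k] : ∀ t : Term k ι, t.WF → ∀ m ∈ t.eval.support, ∀ rc ∈ m.support,
    rc.1 ∈ t.rows ∧ rc.2 ∈ t.cols
  | input r c, _, m, hm, rc, hrc => by
      have hsub : (X (r, c) : MvPolynomial (ι × ι) k).support ⊆ {Finsupp.single (r, c) 1} := by
        rw [X]; exact support_monomial_subset
      obtain rfl : m = Finsupp.single (r, c) 1 := by simpa using hsub hm
      obtain rfl := mem_singleton.1 (Finsupp.support_single_subset hrc)
      simp [rows, cols]
  | const a, _, m, hm, rc, hrc => by
      simp only [eval, C_apply] at hm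
      have hm0 : m = 0 := by simpa using support_monomial_subset hm
      subst hm0; simp at hrc
  | add t u, h, m, hm, rc, hrc => by
      simp only [eval] at hm
      rcases mem_union.1 (support_add hm) with hm | hm
      · exact vars_subset t h.1 m hm rc hrc
      · have := vars_subset u h.2.1 m hm rc hrc
        simp only [rows, cols, ← h.2.2.1, ← h.2.2.2]; exact this
  | smul a t, h, m, hm, rc, hrc => by
      simp only [eval] at hm
      exact vars_subset t h m (support_smul hm) rc hrc
  | mul t u, h, m, hm, rc, hrc => by
      simp only [eval] at hm
      obtain ⟨a, ha, b, hb, rfl⟩ := mem_add.1 (support_mul _ _ hm)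
      simp only [rows, cols, mem_union]
      rcases mem_union.1 (Finsupp.support_add hrc) with h' | h'
      · have := vars_subset t h.1 a ha rc h'; exact ⟨Or.inl this.1, Or.inl this.2⟩
      · have := vars_subset u h.2.1 b hb rc h'; exact ⟨Or.inr this.1, Or.inr this.2⟩

section Window

variable [Fintype ι]

/-- Labels of WINDOW subterms: `N/3 < #cols ≤ 2N/3`, `N = card ι`. -/
def windowLabels (t : Term k ι) : Finset (Finset ι × Finset ι) :=
  t.labels.filter fun L => Fintype.card ι < 3 * L.2.card ∧ 3 * L.2.card ≤ 2 * Fintype.card ι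

/-- THE DESCENT. A monomial in the support of a well-formed term with more than `2N/3` columns
passes through a window subterm: restricted to that subterm's columns it only uses its rows. -/
theorem descent [CommRing k] (hN : 2 ≤ Fintype.card ι) : ∀ t : Term k ι, t.WF →
    ∀ m ∈ t.eval.support, 2 * Fintype.card ι < 3 * t.cols.card →
    ∃ L ∈ t.windowLabels, ∀ rc ∈ m.support, rc.2 ∈ L.2 → rc.1 ∈ L.1
  | input r c, _, m, _, hc => by simp only [cols, card_singleton] at hc; omega
  | const a, _, m, _, hc => by simp [cols] at hc
  | add t u, h, m, hm, hc => by
      simp only [eval, cols] at hm hc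
      rcases mem_union.1 (support_add hm) with hm | hm
      · obtain ⟨L, hL, hL'⟩ := descent hN t h.1 m hm hc
        refine ⟨L, ?_, hL'⟩
        simp only [windowLabels, mem_filter, labels, mem_insert, mem_union] at hL ⊢
        exact ⟨Or.inr (Or.inl hL.1), hL.2⟩
      · obtain ⟨L, hL, hL'⟩ := descent hN u h.2.1 m hm (by rw [h.2.2.2]; exact hc)
        refine ⟨L, ?_, hL'⟩
        simp only [windowLabels, mem_filter, labels, mem_insert, mem_union] at hL ⊢
        exact ⟨Or.inr (Or.inr hL.1), hL.2⟩
  | smul a t, h, m, hm, hc => by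
      simp only [eval, cols] at hm hc
      obtain ⟨L, hL, hL'⟩ := descent hN t h m (support_smul hm) hc
      refine ⟨L, ?_, hL'⟩
      simp only [windowLabels, mem_filter, labels, mem_insert] at hL ⊢
      exact ⟨Or.inr hL.1, hL.2⟩
  | mul t u, h, m, hm, hc => by
      simp only [eval] at hm
      simp only [cols, card_union_of_disjoint h.2.2.2] at hc
      obtain ⟨a, ha, b, hb, rfl⟩ := mem_add.1 (support_mul _ _ hm)
      have hva := vars_subset t h.1 a ha; have hvb := vars_subset u h.2.1 b hb
      have hdis : Disjoint t.cols u.cols := h.2.2.2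
      by_cases ht : Fintype.card ι < 3 * t.cols.card
      · by_cases ht' : 3 * t.cols.card ≤ 2 * Fintype.card ι
        · refine ⟨(t.rows, t.cols), ?_, ?_⟩ -- `t` itself is the window subterm
          · simp only [windowLabels, mem_filter, labels, mem_insert, mem_union]
            exact ⟨Or.inr (Or.inl t.label_mem_labels), ht, ht'⟩
          · intro rc hrc hc2
            rcases mem_union.1 (Finsupp.support_add hrc) with h' | h'
            · exact (hva rc h').1
            · exact absurd (hvb rc h').2 (disjoint_left.1 hdis hc2)
        · obtain ⟨L, hL, hL'⟩ := descent hN t h.1 a ha (by omega) -- descend into `t`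
          have hLc : L.2 ⊆ t.cols := (of_mem_labels t h.1 L (mem_filter.1 hL).1).2
          refine ⟨L, ?_, ?_⟩
          · simp only [windowLabels, mem_filter, labels, mem_insert, mem_union] at hL ⊢
            exact ⟨Or.inr (Or.inl hL.1), hL.2⟩
          · intro rc hrc hc2
            rcases mem_union.1 (Finsupp.support_add hrc) with h' | h'
            · exact hL' rc h' hc2
            · exact absurd (hvb rc h').2 (disjoint_left.1 hdis (hLc hc2))
      · have hu : Fintype.card ι < 3 * u.cols.card := by omega -- else `u` has > N/3 columns
        by_cases hu' : 3 * u.cols.card ≤ 2 * Fintype.card ι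
        · refine ⟨(u.rows, u.cols), ?_, ?_⟩
          · simp only [windowLabels, mem_filter, labels, mem_insert, mem_union]
            exact ⟨Or.inr (Or.inr u.label_mem_labels), hu, hu'⟩
          · intro rc hrc hc2
            rcases mem_union.1 (Finsupp.support_add hrc) with h' | h'
            · exact absurd hc2 (disjoint_left.1 hdis (hva rc h').2)
            · exact (hvb rc h').1
        · obtain ⟨L, hL, hL'⟩ := descent hN u h.2.1 b hb (by omega)
          have hLc : L.2 ⊆ u.cols := (of_mem_labels u h.2.1 L (mem_filter.1 hL).1).2
          refine ⟨L, ?_, ?_⟩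
          · simp only [windowLabels, mem_filter, labels, mem_insert, mem_union] at hL ⊢
            exact ⟨Or.inr (Or.inr hL.1), hL.2⟩
          · intro rc hrc hc2
            rcases mem_union.1 (Finsupp.support_add hrc) with h' | h'
            · exact absurd (hLc hc2) (disjoint_left.1 hdis (hva rc h').2)
            · exact hL' rc h' hc2

/-- The permutations `π` with `π(C) ⊆ R`, for a label `L = (R, C)`. -/
def fiber (L : Finset ι × Finset ι) : Finset (Equiv.Perm ι) :=
  univ.filter fun π => ∀ c ∈ L.2, π c ∈ L.1

/-- Membership in the fiber. -/
theorem mem_fiber {L : Finset ι × Finset ι} {π : Equiv.Perm ι} :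
    π ∈ fiber L ↔ ∀ c ∈ L.2, π c ∈ L.1 := by simp [fiber]

/-- A permutation mapping `C` into an `R` of the same size maps `Cᶜ` into `Rᶜ`. -/
theorem not_mem_of_mem_fiber {L : Finset ι × Finset ι} (hL : L.1.card = L.2.card)
    {π : Equiv.Perm ι} (hπ : π ∈ fiber L) {c : ι} (hc : c ∉ L.2) : π c ∉ L.1 := by
  intro hπc
  obtain ⟨c', hc', hcc'⟩ := surj_on_of_inj_on_of_card_le (s := L.2) (t := L.1)
    (fun c _ => π c) (fun c hc => mem_fiber.1 hπ c hc) (fun _ _ _ _ h => π.injective h) hL.le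
    (π c) hπc
  exact hc (by rw [π.injective hcc']; exact hc')

/-- Restriction of a permutation in the fiber of `(R, C)` to the pair `(C ↪ R, Cᶜ ↪ Rᶜ)`. -/
def fiberMap (L : Finset ι × Finset ι) (hL : L.1.card = L.2.card) (π : ↥(fiber L)) :
    (↥L.2 ↪ ↥L.1) × (↥(L.2ᶜ) ↪ ↥(L.1ᶜ)) :=
  (⟨fun c => ⟨π.1 c, mem_fiber.1 π.2 c c.2⟩,
      fun _ _ h => Subtype.ext (π.1.injective (congrArg Subtype.val h))⟩,
   ⟨fun c => ⟨π.1 c, mem_compl.2 (not_mem_of_mem_fiber hL π.2 (mem_compl.1 c.2))⟩,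
      fun _ _ h => Subtype.ext (π.1.injective (congrArg Subtype.val h))⟩)

/-- `fiberMap` is injective: a permutation is determined by its two restrictions. -/
theorem fiberMap_injective (L : Finset ι × Finset ι) (hL : L.1.card = L.2.card) :
    Function.Injective (fiberMap L hL) := by
  rintro ⟨π, hπ⟩ ⟨π', hπ'⟩ h
  obtain ⟨h1, h2⟩ := Prod.ext_iff.1 h
  refine Subtype.ext (Equiv.ext fun c => ?_)
  by_cases hc : c ∈ L.2
  · have h := congrArg Subtype.val (DFunLike.congr_fun h1 ⟨c, hc⟩)
    simpa [fiberMap] using h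
  · have h := congrArg Subtype.val (DFunLike.congr_fun h2 ⟨c, mem_compl.2 hc⟩)
    simpa [fiberMap] using h

/-- At most `j! (N-j)!` permutations map a `j`-set of columns into a `j`-set of rows. -/
theorem card_fiber_le (L : Finset ι × Finset ι) (hL : L.1.card = L.2.card) :
    (fiber L).card ≤ (L.2.card)! * (Fintype.card ι - L.2.card)! :=
  calc (fiber L).card = Fintype.card ↥(fiber L) := (Fintype.card_coe _).symm
    _ ≤ Fintype.card ((↥L.2 ↪ ↥L.1) × (↥(L.2ᶜ) ↪ ↥(L.1ᶜ))) :=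
        Fintype.card_le_of_injective _ (fiberMap_injective L hL)
    _ = (L.2.card)! * (Fintype.card ι - L.2.card)! := by
        simp only [Fintype.card_prod, Fintype.card_embedding_eq, Fintype.card_coe, card_compl, hL,
          Nat.descFactorial_self]

/-- `⌈N/3⌉`. -/
def third (N : ℕ) : ℕ := (N + 2) / 3

/-- `C(N, ·)` is monotone on `[0, N/2]`. -/
theorem choose_mono_left_half {N a : ℕ} : ∀ d : ℕ, a + d ≤ N / 2 → N.choose a ≤ N.choose (a + d)
  | 0, _ => le_rfl
  | d + 1, h => (choose_mono_left_half d (by omega)).trans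
      (by rw [← add_assoc]; exact Nat.choose_le_succ_of_lt_half_left (by omega))

/-- On the window `N/3 < j ≤ 2N/3`: `C(N, ⌈N/3⌉) ≤ C(N, j)`. -/
theorem choose_third_le {N j : ℕ} (h1 : N < 3 * j) (h2 : 3 * j ≤ 2 * N) :
    N.choose (third N) ≤ N.choose j := by
  by_cases hj : j ≤ N / 2
  · have := choose_mono_left_half (N := N) (a := third N) (j - third N) (by unfold third; omega)
    rwa [show third N + (j - third N) = j by unfold third; omega] at this
  · rw [← Nat.choose_symm (show j ≤ N by omega)]
    have := choose_mono_left_half (N := N) (a := third N) (N - j - third N)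
      (by unfold third; omega)
    rwa [show third N + (N - j - third N) = N - j by unfold third; omega] at this

/-- On the window `N/3 < j ≤ 2N/3`: `j!(N-j)! ≤ ⌈N/3⌉!(N-⌈N/3⌉)!`. -/
theorem factorial_window_le {N j : ℕ} (h1 : N < 3 * j) (h2 : 3 * j ≤ 2 * N) :
    j ! * (N - j)! ≤ (third N)! * (N - third N)! := by
  have hj : j ≤ N := by omega
  have ha : third N ≤ N := by unfold third; omega
  have key : N.choose (third N) * (j ! * (N - j)!) ≤
      N.choose (third N) * ((third N)! * (N - third N)!) :=
    calc N.choose (third N) * (j ! * (N - j)!)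
        ≤ N.choose j * (j ! * (N - j)!) := Nat.mul_le_mul_right _ (choose_third_le h1 h2)
      _ = N ! := by rw [← mul_assoc, Nat.choose_mul_factorial_mul_factorial hj]
      _ = N.choose (third N) * ((third N)! * (N - third N)!) := by
          rw [← mul_assoc, Nat.choose_mul_factorial_mul_factorial ha]
  exact Nat.le_of_mul_le_mul_left key (Nat.choose_pos ha)

/-- MAIN THEOREM. A well-formed bi-set-multilinear term with full column label whose output has
every permutation monomial in its support meets at least `C(N, ⌈N/3⌉)` distinct labels in the window
`N/3 < #cols ≤ 2N/3` (`N = card ι ≥ 2`). -/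
theorem choose_le_card_windowLabels [CommRing k] (hN : 2 ≤ Fintype.card ι) (t : Term k ι)
    (ht : t.WF) (hcols : t.cols = univ)
    (hsupp : ∀ π : Equiv.Perm ι, permMonomial π ∈ t.eval.support) :
    (Fintype.card ι).choose (third (Fintype.card ι)) ≤ t.windowLabels.card := by
  have hcover : (univ : Finset (Equiv.Perm ι)) ⊆ t.windowLabels.biUnion fiber := by
    intro π _
    have hc : 2 * Fintype.card ι < 3 * t.cols.card := by rw [hcols, card_univ]; omega
    obtain ⟨L, hL, hL'⟩ := descent hN t ht (permMonomial π) (hsupp π) hc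
    refine mem_biUnion.2 ⟨L, hL, mem_fiber.2 fun c hc2 => hL' (π c, c) ?_ hc2⟩
    rw [Finsupp.mem_support_iff, permMonomial_apply]; simp
  have hsum : (Fintype.card ι)! ≤ t.windowLabels.card *
      ((third (Fintype.card ι))! * (Fintype.card ι - third (Fintype.card ι))!) :=
    calc (Fintype.card ι)! = (univ : Finset (Equiv.Perm ι)).card := by
            rw [card_univ, Fintype.card_perm]
      _ ≤ (t.windowLabels.biUnion fiber).card := card_le_card hcover
      _ ≤ ∑ L ∈ t.windowLabels, (fiber L).card := card_biUnion_le
      _ ≤ ∑ L ∈ t.windowLabels,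
            (third (Fintype.card ι))! * (Fintype.card ι - third (Fintype.card ι))! := by
            refine sum_le_sum fun L hL => ?_
            have hlab := mem_filter.1 hL
            exact (card_fiber_le L (of_mem_labels t ht L hlab.1).1).trans
              (factorial_window_le hlab.2.1 hlab.2.2)
      _ = _ := by rw [sum_const, smul_eq_mul]
  have ha : third (Fintype.card ι) ≤ Fintype.card ι := by unfold third; omega
  rw [← Nat.choose_mul_factorial_mul_factorial ha, mul_assoc] at hsum
  exact Nat.le_of_mul_le_mul_right hsum (Nat.mul_pos (Nat.factorial_pos _) (Nat.factorial_pos _))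

end Window

end Term

/-! ### Instances: permanent and determinant -/

section Instances

variable {k : Type u} [CommRing k] [Nontrivial k] {ι : Type v} [Fintype ι] [DecidableEq ι]

/-- **per.** Every well-formed bi-set-multilinear term computing `per_ι` (`card ι ≥ 2`) meets at
least `C(N, ⌈N/3⌉)` window labels (hence has at least that many nodes; likewise for circuits). -/
theorem perPoly_lower_bound (hN : 2 ≤ Fintype.card ι) (t : Term k ι) (ht : t.WF)
    (hcols : t.cols = univ) (heval : t.eval = perPoly ι k) :
    (Fintype.card ι).choose (Term.third (Fintype.card ι)) ≤ t.windowLabels.card :=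
  Term.choose_le_card_windowLabels hN t ht hcols fun π => by
    rw [heval, mem_support_iff, coeff_permMonomial_perPoly]; exact one_ne_zero

/-- **det.** The same bound for the determinant: the method is det-blind. -/
theorem detPoly_lower_bound (hN : 2 ≤ Fintype.card ι) (t : Term k ι) (ht : t.WF)
    (hcols : t.cols = univ) (heval : t.eval = detPoly ι k) :
    (Fintype.card ι).choose (Term.third (Fintype.card ι)) ≤ t.windowLabels.card :=
  Term.choose_le_card_windowLabels hN t ht hcols fun π => by
    rw [heval, mem_support_iff, coeff_permMonomial_detPoly]; exact intCast_sign_ne_zero k π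

end Instances

end Summit.ValiantsHypothesis.ValiantsHypothesis.Theorems.BiSetMultilinearCounting
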